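import Summits.Ventures.QEC.CircuitDistance.PortCoverBase
import Summits.Ventures.QEC.CircuitDistance.SchedCoverFast
import HarnessLib

/-!
# Q4 lane, ₛ-spine (9B): soundness of the BUCKET coverage checker `covers₂` for any CNOT order (`PortCoverBase.lean` re-pointed to
# `xDEMₛ/zDEMₛ σ` under `hσ : σ.CycleFacts S`; venture QEC, experiment cell CDX, seat qec-cdx-type-2; proofs verbatim; nothing here
# asserts a value of `d_circ`)

Reused unchanged (order-free): `lmin`, `Fibre.Leaf.nullBuckets`, `XTable.baseF/baseList`, `keysOf`, `synZ_trQ`/`synX_trQ`,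
`colFormula_base`, `keysOf_baseList`, `nullHit`, `bucketBound`, `XTable.covers₂`/`ZTable.covers₂`, `keysOf_ite`. Re-pointed:
**`xcovers₂_soundₛ`/`zcovers₂_soundₛ`** (⇒ `Fibre.Covers₀` for `xDEMₛ`/`zDEMₛ`, the input of `no_xLogical_of_leavesCₛ`).
-/

namespace Summit.Ventures.QEC.CircuitDistance

open Literature.InformationTheory.QuantumCodes

variable {ℓ m : ℕ} [NeZero ℓ] [NeZero m]

/-- **Soundness of `covers₂`** (`X`), any order with the cycle facts (cf. `xcovers₂_sound`; the bucket checker `XTable.covers₂` is order-free). -/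
theorem xcovers₂_soundₛ {σ : SMSchedule} {S : SMCode ℓ m} (hσ : σ.CycleFacts S) (T : XTable ℓ m) (hS : T.ShapeCorrectₛ σ S)
    (Nc : ℕ) (e : LeafEntry ℓ m) (h : T.covers₂ S Nc e = true) : Fibre.Covers₀ (xDEMₛ σ S T Nc) (scope Nc) encDet e.word e.leaf := by
  unfold XTable.covers₂ at h
  simp only [Bool.and_eq_true, decide_eq_true_eq, List.all_eq_true, List.mem_range, Bool.or_eq_true, List.mem_map,
    forall_exists_index, and_imp] at h
  obtain ⟨⟨hlen, hall⟩, hnull⟩ := h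
  refine ⟨encDet_injective, hlen, fun f hf j hcls => ?_, ?_⟩
  · obtain ⟨h₁, h₂⟩ := hf
    change (f.xKind.bind fun ki => (T.cls ki.1).map (trQ ki.2)) = some e.word[j] at hcls
    rcases hk : f.xKind with _ | ⟨k, i⟩
    · rw [hk] at hcls; simp at hcls
    · rw [hk, Option.bind_some] at hcls
      have hkall : k ∈ XKind.all := XKind.mem_all k (fun lay => Fault.xKind_ne_zero hk lay)
      have hjk := hall j j.2 _ k hkall rfl
      rcases hc : T.cls k with _ | g₀
      · rw [hc] at hcls; simp at hcls
      · simp only [hc] at hcls hjk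
        simp only [Option.map_some, Option.some.injEq] at hcls
        rw [decide_eq_true_eq] at hjk
        have hwd : e.word.getD (j : ℕ) ∅ = e.word[j] := List.getD_eq_getElem _ _ j.2
        rw [hwd] at hjk
        obtain ⟨c, hc', hcc⟩ := hjk i (mem_candSet hcls) hcls (f.cyc - 1) (by omega)
        refine ⟨c, hc', ?_⟩
        rw [hcc, T.keysOf_ite S Nc k i, Nat.sub_add_cancel h₁, XTable.detFast_eq_xDetₛ hσ (hS k hkall) Nc i f.cyc h₁ h₂,
          ← xDetₛ_eq_of_xKind σ S Nc f hk]
        rfl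
  · by_cases hb : e.leaf.budget = 0
    · exact Or.inl hb
    · refine Or.inr fun f hf hcls => ?_
      rcases hnull with hnull | hnull
      · exact absurd hnull hb
      obtain ⟨h₁, h₂⟩ := hf
      change (f.xKind.bind fun ki => (T.cls ki.1).map (trQ ki.2)) = none at hcls
      rcases hk : f.xKind with _ | ⟨k, i⟩
      · exact Or.inl (xDetₛ_eq_empty_of_xKind σ S Nc f hk)
      · rw [hk, Option.bind_some] at hcls
        have hkall : k ∈ XKind.all := XKind.mem_all k (fun lay => Fault.xKind_ne_zero hk lay)
        have hcn : T.cls k = none := by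
          rcases hc : T.cls k with _ | g₀
          · rfl
          · rw [hc] at hcls; simp at hcls
        have hki := hnull _ k hkall rfl
        simp only [hcn] at hki
        rw [List.all_eq_true] at hki
        have hi := hki i (mem_monoList i)
        rw [List.all_eq_true] at hi
        have hc0 := hi (f.cyc - 1) (List.mem_range.2 (by omega))
        have hcol : (T.detFast S Nc k i (f.cyc - 1 + 1)).image encDet = (xDetₛ σ S Nc f).image encDet := by
          rw [Nat.sub_add_cancel h₁, XTable.detFast_eq_xDetₛ hσ (hS k hkall) Nc i f.cyc h₁ h₂, ← xDetₛ_eq_of_xKind σ S Nc f hk]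
        rcases nullHit_sound e.leaf _ _ hc0 with h0 | ⟨c, hcn', hcc⟩
        · left
          rw [T.keysOf_ite S Nc k i, hcol, Finset.image_eq_empty] at h0; exact h0
        · right
          exact ⟨c, hcn', by rw [hcc, T.keysOf_ite S Nc k i, hcol]; rfl⟩

/-- **Soundness of `covers₂`** (`Z`), any order with the cycle facts (cf. `zcovers₂_sound`). -/
theorem zcovers₂_soundₛ {σ : SMSchedule} {S : SMCode ℓ m} (hσ : σ.CycleFacts S) (T : ZTable ℓ m) (hS : T.ShapeCorrectₛ σ S)
    (Nc : ℕ) (e : LeafEntry ℓ m) (h : T.covers₂ S Nc e = true) : Fibre.Covers₀ (zDEMₛ σ S T Nc) (scope Nc) encDet e.word e.leaf := by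
  unfold ZTable.covers₂ at h
  simp only [Bool.and_eq_true, decide_eq_true_eq, List.all_eq_true, List.mem_range, Bool.or_eq_true, List.mem_map,
    forall_exists_index, and_imp] at h
  obtain ⟨⟨hlen, hall⟩, hnull⟩ := h
  refine ⟨encDet_injective, hlen, fun f hf j hcls => ?_, ?_⟩
  · obtain ⟨h₁, h₂⟩ := hf
    change (f.zKind.bind fun ki => (T.cls ki.1).map (trQ ki.2)) = some e.word[j] at hcls
    rcases hk : f.zKind with _ | ⟨k, i⟩
    · rw [hk] at hcls; simp at hcls
    · rw [hk, Option.bind_some] at hcls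
      have hkall : k ∈ ZKind.all := ZKind.mem_all k (fun lay => Fault.zKind_ne_zero hk lay)
      have hjk := hall j j.2 _ k hkall rfl
      rcases hc : T.cls k with _ | g₀
      · rw [hc] at hcls; simp at hcls
      · simp only [hc] at hcls hjk
        simp only [Option.map_some, Option.some.injEq] at hcls
        rw [decide_eq_true_eq] at hjk
        have hwd : e.word.getD (j : ℕ) ∅ = e.word[j] := List.getD_eq_getElem _ _ j.2
        rw [hwd] at hjk
        obtain ⟨c, hc', hcc⟩ := hjk i (mem_candSet hcls) hcls (f.cyc - 1) (by omega)
        refine ⟨c, hc', ?_⟩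
        rw [hcc, T.keysOf_baseList S k i, Nat.sub_add_cancel h₁, ZTable.detFast_eq_zDetₛ hσ (hS k hkall) Nc i f.cyc h₁ h₂,
          ← zDetₛ_eq_of_zKind σ S Nc f hk]
        rfl
  · by_cases hb : e.leaf.budget = 0
    · exact Or.inl hb
    · refine Or.inr fun f hf hcls => ?_
      rcases hnull with hnull | hnull
      · exact absurd hnull hb
      obtain ⟨h₁, h₂⟩ := hf
      change (f.zKind.bind fun ki => (T.cls ki.1).map (trQ ki.2)) = none at hcls
      rcases hk : f.zKind with _ | ⟨k, i⟩
      · exact Or.inl (zDetₛ_eq_empty_of_zKind σ S Nc f hk)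
      · rw [hk, Option.bind_some] at hcls
        have hkall : k ∈ ZKind.all := ZKind.mem_all k (fun lay => Fault.zKind_ne_zero hk lay)
        have hcn : T.cls k = none := by
          rcases hc : T.cls k with _ | g₀
          · rfl
          · rw [hc] at hcls; simp at hcls
        have hki := hnull _ k hkall rfl
        simp only [hcn] at hki
        rw [List.all_eq_true] at hki
        have hi := hki i (mem_monoList i)
        rw [List.all_eq_true] at hi
        have hc0 := hi (f.cyc - 1) (List.mem_range.2 (by omega))
        have hcol : (T.detFast S k i (f.cyc - 1 + 1)).image encDet = (zDetₛ σ S Nc f).image encDet := by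
          rw [Nat.sub_add_cancel h₁, ZTable.detFast_eq_zDetₛ hσ (hS k hkall) Nc i f.cyc h₁ h₂, ← zDetₛ_eq_of_zKind σ S Nc f hk]
        rcases nullHit_sound e.leaf _ _ hc0 with h0 | ⟨c, hcn', hcc⟩
        · left
          rw [T.keysOf_baseList S k i, hcol, Finset.image_eq_empty] at h0; exact h0
        · right
          exact ⟨c, hcn', by rw [hcc, T.keysOf_baseList S k i, hcol]; rfl⟩


end Summit.Ventures.QEC.CircuitDistance
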